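import Mathlib
import HarnessLib

/-!
# Route `KLProgramme` — child `KLRegimeVolumeLimitV7` (stmt-HubbardSuperconductivity-19665), order-`U²` rung of the volume-limit
# slot: the two-loop (sunset) MATSUBARA DOUBLE SUM is bounded UNIFORMLY in the external frequency
# (cell gate-hubbard-kl, seat hubbard-kl-k3c4-p1; plan g10 ruling (α) 2026-08-26T16:19:44Z, re-point (2))

WHY.  The order-`U²` (sunset) truncation of the two-leg vertex function at inverse temperature `β` is, per external fermionic
Matsubara integer `n`, a double sum over internal Matsubara integers `(a, b)` of momentum double-averages of
`ĝ(ω_a, ·) ĝ(ω_b, ·) ĝ(ω_{n+b-a}, ·)`, `ĝ(ω, p) = (-iω + e_K(p))⁻¹`, `ω_a = π(2a+1)/β`.  Since `|ĝ(ω_a, p)| ≤ |ω_a|⁻¹ =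
(β/2π)·|a + ½|⁻¹`, the termwise majorant of the `(a, b)` term is a constant times `(|a+½| |b+½| |n+b-a+½|)⁻¹`.  This family is
summable over `(a, b) ∈ ℤ²` for each `n`, with a sum bounded UNIFORMLY in `n` — but it admits no `n`-uniform termwise majorant
(`Σ_{a,b} sup_n (…) = ∞`), which is why the Tannery bridge for this rung is `finalTwoLegVolLimit_of_termwise_freq`
(`KLProgrammeKLRegimeVolumeLimitTannery`, frequency-dependent majorants).  The uniform bound is proved here by an elementary
device (no Young/Hölder inequality for sequences is needed): for positive reals, `(xyz)⁻¹ ≤ (x√x)⁻¹(y√y)⁻¹ + (x√x)⁻¹(z√z)⁻¹ +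
(y√y)⁻¹(z√z)⁻¹` (drop the largest of the three), and each of the three resulting double sums is, after an integer shear of `ℤ²`,
the square `G²` of the convergent sum `G = Σ_{a ∈ ℤ} |a+½|^{-3/2}`:

* `klsf_inv_mul_three_le` — the pointwise inequality;
* `klsf_summable_threeHalves` — `Σ_{a ∈ ℤ} (|a+½|·√|a+½|)⁻¹ < ∞` (`Real.summable_one_div_int_add_rpow`, exponent `3/2`);
* `klsf_summable_sunsetWeight`, **`klsf_tsum_sunsetWeight_le`** — for every `n ∈ ℤ`,
  `Σ_{(a,b) ∈ ℤ²} (|a+½| |b+½| |n+b-a+½|)⁻¹ ≤ 3 G²` (summable, bound independent of `n`).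

Pure real analysis (Mathlib); nothing is asserted about the model.  Reference for the role of the bound: G. Benfatto, A. Giuliani,
V. Mastropietro, Ann. Henri Poincaré 7 (2006) 809–898, §2.1 (2.3)–(2.8) (finite-temperature perturbation theory; the second-order
self-energy).
-/

noncomputable section

namespace Summit.HubbardSuperconductivity.HubbardSuperconductivity.Theorems.KLRegimeSplit

set_option linter.dupNamespace false -- summit = problem name (single-conjunct summit), D-0017

open Real

/-! ## §1 The pointwise inequality -/

/-- If `x, y ≤ z` (all positive) then `(xyz)⁻¹ ≤ (x√x)⁻¹ (y√y)⁻¹` (`√x √y ≤ z`). -/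
theorem klsf_inv_mul_three_le_of_le {x y z : ℝ} (hx : 0 < x) (hy : 0 < y) (hxz : x ≤ z) (hyz : y ≤ z) :
    (x * y * z)⁻¹ ≤ (x * Real.sqrt x)⁻¹ * (y * Real.sqrt y)⁻¹ := by
  rw [← mul_inv]
  apply inv_anti₀ (by positivity)
  have hs : Real.sqrt x * Real.sqrt y ≤ z := by
    calc Real.sqrt x * Real.sqrt y ≤ Real.sqrt z * Real.sqrt z :=
          mul_le_mul (Real.sqrt_le_sqrt hxz) (Real.sqrt_le_sqrt hyz) (Real.sqrt_nonneg _) (Real.sqrt_nonneg _)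
      _ = z := Real.mul_self_sqrt (hx.le.trans hxz)
  calc x * Real.sqrt x * (y * Real.sqrt y) = x * y * (Real.sqrt x * Real.sqrt y) := by ring
    _ ≤ x * y * z := by gcongr

/-- **Drop the largest factor**: for positive reals,
`(xyz)⁻¹ ≤ (x√x)⁻¹(y√y)⁻¹ + (x√x)⁻¹(z√z)⁻¹ + (y√y)⁻¹(z√z)⁻¹`. -/
theorem klsf_inv_mul_three_le {x y z : ℝ} (hx : 0 < x) (hy : 0 < y) (hz : 0 < z) :
    (x * y * z)⁻¹ ≤ (x * Real.sqrt x)⁻¹ * (y * Real.sqrt y)⁻¹ + (x * Real.sqrt x)⁻¹ * (z * Real.sqrt z)⁻¹ +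
      (y * Real.sqrt y)⁻¹ * (z * Real.sqrt z)⁻¹ := by
  have h1 : 0 ≤ (x * Real.sqrt x)⁻¹ * (y * Real.sqrt y)⁻¹ := by positivity
  have h2 : 0 ≤ (x * Real.sqrt x)⁻¹ * (z * Real.sqrt z)⁻¹ := by positivity
  have h3 : 0 ≤ (y * Real.sqrt y)⁻¹ * (z * Real.sqrt z)⁻¹ := by positivity
  rcases le_total x z with hxz | hzx
  · rcases le_total y z with hyz | hzy
    · -- `z` is the largest
      linarith [klsf_inv_mul_three_le_of_le hx hy hxz hyz]
    · -- `y` is the largest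
      have h := klsf_inv_mul_three_le_of_le hx hz (hxz.trans hzy) hzy
      have he : x * z * y = x * y * z := by ring
      rw [he] at h
      linarith
  · rcases le_total y x with hyx | hxy
    · -- `x` is the largest
      have h := klsf_inv_mul_three_le_of_le hy hz hyx hzx
      have he : y * z * x = x * y * z := by ring
      rw [he] at h
      linarith
    · -- `y` is the largest
      have h := klsf_inv_mul_three_le_of_le hx hz hxy (hzx.trans hxy)
      have he : x * z * y = x * y * z := by ring
      rw [he] at h
      linarith

/-! ## §2 The one-dimensional sum `Σ_{a ∈ ℤ} |a + ½|^{-3/2}` -/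

/-- `a + ½ ≠ 0` for an integer `a`, so `0 < |a + ½|`. -/
theorem klsf_abs_add_half_pos (a : ℤ) : 0 < |(a : ℝ) + 1 / 2| := by
  rw [abs_pos]
  intro h
  have h2 : (2 * a + 1 : ℤ) = 0 := by
    have : (2 : ℝ) * a + 1 = 0 := by linarith
    exact_mod_cast this
  omega

/-- `|a+½| √|a+½| = |a+½|^{3/2}`. -/
theorem klsf_mul_sqrt_eq_rpow (a : ℤ) :
    |(a : ℝ) + 1 / 2| * Real.sqrt |(a : ℝ) + 1 / 2| = |(a : ℝ) + 1 / 2| ^ ((3 : ℝ) / 2) := by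
  have hpos := klsf_abs_add_half_pos a
  rw [Real.sqrt_eq_rpow, show ((3 : ℝ) / 2) = 1 + 1 / 2 by norm_num, Real.rpow_add hpos, Real.rpow_one]

/-- **`Σ_{a ∈ ℤ} (|a+½| √|a+½|)⁻¹ < ∞`** (a `p`-series with `p = 3/2`). -/
theorem klsf_summable_threeHalves :
    Summable fun a : ℤ => (|(a : ℝ) + 1 / 2| * Real.sqrt |(a : ℝ) + 1 / 2|)⁻¹ := by
  have h := (Real.summable_one_div_int_add_rpow (1 / 2) ((3 : ℝ) / 2)).2 (by norm_num)
  refine h.congr fun a => ?_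
  rw [klsf_mul_sqrt_eq_rpow, one_div]

/-- The terms are nonnegative. -/
theorem klsf_threeHalves_nonneg (a : ℤ) : 0 ≤ (|(a : ℝ) + 1 / 2| * Real.sqrt |(a : ℝ) + 1 / 2|)⁻¹ := by
  positivity

/-! ## §3 The two-loop sum, uniformly in the external frequency -/

/-- The product family `(a, b) ↦ g(a) g(b)` is summable with sum `G²`, `G = Σ_a (|a+½|√|a+½|)⁻¹`. -/
theorem klsf_hasSum_prod :
    HasSum (fun ab : ℤ × ℤ => (|(ab.1 : ℝ) + 1 / 2| * Real.sqrt |(ab.1 : ℝ) + 1 / 2|)⁻¹ *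
        (|(ab.2 : ℝ) + 1 / 2| * Real.sqrt |(ab.2 : ℝ) + 1 / 2|)⁻¹)
      ((∑' a : ℤ, (|(a : ℝ) + 1 / 2| * Real.sqrt |(a : ℝ) + 1 / 2|)⁻¹) ^ 2) := by
  have hn : Summable fun a : ℤ => ‖(|(a : ℝ) + 1 / 2| * Real.sqrt |(a : ℝ) + 1 / 2|)⁻¹‖ := by
    refine klsf_summable_threeHalves.congr fun a => ?_
    rw [Real.norm_of_nonneg (klsf_threeHalves_nonneg a)]
  have hs : Summable fun ab : ℤ × ℤ => (|(ab.1 : ℝ) + 1 / 2| * Real.sqrt |(ab.1 : ℝ) + 1 / 2|)⁻¹ *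
      (|(ab.2 : ℝ) + 1 / 2| * Real.sqrt |(ab.2 : ℝ) + 1 / 2|)⁻¹ := summable_mul_of_summable_norm hn hn
  rw [sq, tsum_mul_tsum_of_summable_norm hn hn]
  exact hs.hasSum

/-- The shear `(a, b) ↦ (a, n + b - a)` of `ℤ²` (third frequency as second coordinate). -/
theorem klsf_shear₁_bijective (n : ℤ) : Function.Bijective fun ab : ℤ × ℤ => (ab.1, n + ab.2 - ab.1) := by
  refine ⟨fun ab ab' h => ?_, fun uv => ⟨(uv.1, uv.2 - n + uv.1), ?_⟩⟩
  · simp only [Prod.mk.injEq] at h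
    obtain ⟨h1, h2⟩ := h
    exact Prod.ext h1 (by omega)
  · refine Prod.ext rfl ?_
    show n + (uv.2 - n + uv.1) - uv.1 = uv.2
    ring

/-- The shear `(a, b) ↦ (b, n + b - a)` of `ℤ²`. -/
theorem klsf_shear₂_bijective (n : ℤ) : Function.Bijective fun ab : ℤ × ℤ => (ab.2, n + ab.2 - ab.1) := by
  refine ⟨fun ab ab' h => ?_, fun uv => ⟨(n + uv.1 - uv.2, uv.1), ?_⟩⟩
  · simp only [Prod.mk.injEq] at h
    obtain ⟨h1, h2⟩ := h
    exact Prod.ext (by omega) h1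
  · refine Prod.ext rfl ?_
    show n + uv.1 - (n + uv.1 - uv.2) = uv.2
    ring

/-- **The sunset frequency weight is summable over `ℤ²` with an `n`-uniform bound**: for every external Matsubara integer `n`,
`Σ_{(a,b) ∈ ℤ²} (|a+½| |b+½| |n+b-a+½|)⁻¹ ≤ 3 G²`, `G = Σ_{a ∈ ℤ} (|a+½| √|a+½|)⁻¹`; this is the summability half. -/
theorem klsf_summable_sunsetWeight (n : ℤ) :
    Summable fun ab : ℤ × ℤ =>
      (|(ab.1 : ℝ) + 1 / 2| * |(ab.2 : ℝ) + 1 / 2| * |((n + ab.2 - ab.1 : ℤ) : ℝ) + 1 / 2|)⁻¹ := by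
  -- notation-free abbreviations
  set g : ℤ → ℝ := fun a => (|(a : ℝ) + 1 / 2| * Real.sqrt |(a : ℝ) + 1 / 2|)⁻¹ with hg
  have hg0 : ∀ a, 0 ≤ g a := fun a => klsf_threeHalves_nonneg a
  have hprod : Summable fun ab : ℤ × ℤ => g ab.1 * g ab.2 := klsf_hasSum_prod.summable
  have h1 : Summable fun ab : ℤ × ℤ => g ab.1 * g (n + ab.2 - ab.1) :=
    (Equiv.summable_iff (Equiv.ofBijective _ (klsf_shear₁_bijective n))).2 hprod
  have h2 : Summable fun ab : ℤ × ℤ => g ab.2 * g (n + ab.2 - ab.1) :=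
    (Equiv.summable_iff (Equiv.ofBijective _ (klsf_shear₂_bijective n))).2 hprod
  refine Summable.of_nonneg_of_le (fun ab => by positivity) (fun ab => ?_) ((hprod.add h1).add h2)
  exact klsf_inv_mul_three_le (klsf_abs_add_half_pos _) (klsf_abs_add_half_pos _) (klsf_abs_add_half_pos _)

/-- **The sunset frequency weight has an `n`-UNIFORM sum**: for every external Matsubara integer `n`,
`Σ_{(a,b) ∈ ℤ²} (|a+½| |b+½| |n+b-a+½|)⁻¹ ≤ 3 · (Σ_{a ∈ ℤ} (|a+½| √|a+½|)⁻¹)²`. -/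
theorem klsf_tsum_sunsetWeight_le (n : ℤ) :
    ∑' ab : ℤ × ℤ, (|(ab.1 : ℝ) + 1 / 2| * |(ab.2 : ℝ) + 1 / 2| * |((n + ab.2 - ab.1 : ℤ) : ℝ) + 1 / 2|)⁻¹ ≤
      3 * (∑' a : ℤ, (|(a : ℝ) + 1 / 2| * Real.sqrt |(a : ℝ) + 1 / 2|)⁻¹) ^ 2 := by
  set g : ℤ → ℝ := fun a => (|(a : ℝ) + 1 / 2| * Real.sqrt |(a : ℝ) + 1 / 2|)⁻¹ with hg
  set G : ℝ := ∑' a : ℤ, g a with hG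
  have hprodHas : HasSum (fun ab : ℤ × ℤ => g ab.1 * g ab.2) (G ^ 2) := klsf_hasSum_prod
  have hprod : Summable fun ab : ℤ × ℤ => g ab.1 * g ab.2 := hprodHas.summable
  have e1 := Equiv.ofBijective _ (klsf_shear₁_bijective n)
  have h1Has : HasSum (fun ab : ℤ × ℤ => g ab.1 * g (n + ab.2 - ab.1)) (G ^ 2) := by
    have h := (Equiv.hasSum_iff (Equiv.ofBijective _ (klsf_shear₁_bijective n)) (f := fun uv : ℤ × ℤ => g uv.1 * g uv.2)
      (a := G ^ 2)).2 hprodHas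
    exact h
  have h2Has : HasSum (fun ab : ℤ × ℤ => g ab.2 * g (n + ab.2 - ab.1)) (G ^ 2) := by
    have h := (Equiv.hasSum_iff (Equiv.ofBijective _ (klsf_shear₂_bijective n)) (f := fun uv : ℤ × ℤ => g uv.1 * g uv.2)
      (a := G ^ 2)).2 hprodHas
    exact h
  have hsum : HasSum (fun ab : ℤ × ℤ => g ab.1 * g ab.2 + g ab.1 * g (n + ab.2 - ab.1) + g ab.2 * g (n + ab.2 - ab.1))
      (G ^ 2 + G ^ 2 + G ^ 2) := (hprodHas.add h1Has).add h2Has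
  have hle : ∀ ab : ℤ × ℤ,
      (|(ab.1 : ℝ) + 1 / 2| * |(ab.2 : ℝ) + 1 / 2| * |((n + ab.2 - ab.1 : ℤ) : ℝ) + 1 / 2|)⁻¹ ≤
        g ab.1 * g ab.2 + g ab.1 * g (n + ab.2 - ab.1) + g ab.2 * g (n + ab.2 - ab.1) := fun ab =>
    klsf_inv_mul_three_le (klsf_abs_add_half_pos _) (klsf_abs_add_half_pos _) (klsf_abs_add_half_pos _)
  calc ∑' ab : ℤ × ℤ, (|(ab.1 : ℝ) + 1 / 2| * |(ab.2 : ℝ) + 1 / 2| * |((n + ab.2 - ab.1 : ℤ) : ℝ) + 1 / 2|)⁻¹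
      ≤ ∑' ab : ℤ × ℤ, (g ab.1 * g ab.2 + g ab.1 * g (n + ab.2 - ab.1) + g ab.2 * g (n + ab.2 - ab.1)) :=
        (klsf_summable_sunsetWeight n).tsum_le_tsum hle hsum.summable
    _ = G ^ 2 + G ^ 2 + G ^ 2 := hsum.tsum_eq
    _ = 3 * G ^ 2 := by ring

end Summit.HubbardSuperconductivity.HubbardSuperconductivity.Theorems.KLRegimeSplit

end
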